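import Mathlib
import HarnessLib

/-!
# Route `EntropyBudgetEquipartition`, crux `EntropyBudgetTransfer` (stmt-QuantumFields-22401) — helper «KT3 → KT»,
# part 4: the reference-side covariance is `L²`-stable (tools for hypothesis (ii) of `twoSidedLaw_of_referencePairs`)

HONEST LABEL: bookkeeping toward a RECORD-label rung (R2ξ-G, `WeakCouplingRates.XiPow`); nothing here bears on the
Yang–Mills mass gap and nothing is specific to gauge theories.

Part 3 (`EntropyBudgetEquipartitionCovTransferLaw.lean`) reduced the crux to reference pairs `(X', Y')` whose covariance is
`σ C(n)² + O(β^{−κ₁})` (hypothesis (ii)).  Because closeness in total variation is NOT stable under perturbing the observable,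
the reference pair has to be the SAME observable `β·cost` read on a Gaussian(-mixture) configuration law, i.e.
`X' = q₀ + r₀`, `Y' = q_n + r_n` with `q` the quadratic (free-gluon) part and `r = O(β |a|⁴)` the quartic remainder, and, for a
DLR mixture over exterior data, a MIXTURE of such laws.  The covariance side absorbs both effects in `L²`:

* `sq_cov_le` — Cauchy–Schwarz for the covariance, `Cov(X,Y)² ≤ E[X²] E[Y²]` (`MemLp 2`; via the centred variables and
  `Var ≤ E[·²]`), and `abs_cov_le` — `|Cov(X,Y)| ≤ √E[X²] √E[Y²]`;
* `abs_cov_add_sub_cov_le` — `|Cov(X+R, Y+S) − Cov(X,Y)| ≤ √E[R²] √E[Y²] + √E[X²] √E[S²] + √E[R²] √E[S²]`: the quartic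
  remainder moves the reference covariance by `O(‖r‖₂)`, so (ii) holds with `κ₁ = 1` as soon as `‖r‖₂ = O(β^{−1})`, `‖q‖₂ = O(1)`
  and `Cov(q₀, q_n) = σ C(n)²` (the Wick/Isserlis identity of the sibling line, `SourcedPressureIncrement.Birth.gauss_firstCumulant`);
* `cov_mixture_eq` / `abs_cov_mixture_sub_le` — LAW OF TOTAL COVARIANCE in integral form: if the pair law is a mixture
  (`E[F] = ∫ E_s[F] dμ(s)` for `F ∈ {X, Y, XY}`), then `Cov(X,Y) = ∫ Cov_s(X,Y) dμ(s) + Cov_μ(s ↦ E_s X, s ↦ E_s Y)` and the second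
  («wall») term is at most `√Var_μ(E_s X) · √Var_μ(E_s Y)`: what a DLR-mixture reference must control is the `μ`-VARIANCE OF THE
  BOUNDARY-CONDITIONAL MEANS of the two costs — the place where the local-Gaussianity wall (items 8937/8938, crux `BulkAllGroups`
  22255 of the sibling route) re-enters this line.

Written by the width seat 2/3 of line `ym-line-ebe-p1` as `--supports stmt-QuantumFields-22401`. [folklore]
-/

set_option autoImplicit false

noncomputable section

open MeasureTheory Set

namespace Summit.QuantumFields.YangMills.Theorems.EntropyBudgetEquipartition.CovTransfer

variable {E : Type*} [MeasurableSpace E] {P : Measure E} [IsProbabilityMeasure P]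

/-! ### Cauchy–Schwarz for the covariance -/

omit [IsProbabilityMeasure P] in
/-- Cauchy–Schwarz for real integrals, `(∫ f g)² ≤ (∫ f²)(∫ g²)` (`f, g ∈ L²`; discriminant of `t ↦ ∫ (t f − g)²`). [folklore] -/
theorem sq_integral_mul_le {f g : E → ℝ} (hf : MemLp f 2 P) (hg : MemLp g 2 P) :
    (∫ x, f x * g x ∂P) ^ 2 ≤ (∫ x, f x ^ 2 ∂P) * (∫ x, g x ^ 2 ∂P) := by
  have hf2 : Integrable (fun x => f x ^ 2) P := hf.integrable_sq
  have hg2 : Integrable (fun x => g x ^ 2) P := hg.integrable_sq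
  have hfg : Integrable (fun x => f x * g x) P := hf.integrable_mul hg
  set A := ∫ x, f x ^ 2 ∂P with hA
  set B := ∫ x, f x * g x ∂P with hB
  set C := ∫ x, g x ^ 2 ∂P with hC
  have hA0 : 0 ≤ A := integral_nonneg fun x => sq_nonneg _
  have hC0 : 0 ≤ C := integral_nonneg fun x => sq_nonneg _
  have quad : ∀ t : ℝ, 0 ≤ t ^ 2 * A - 2 * t * B + C := by
    intro t
    have h1 : 0 ≤ ∫ x, (t * f x - g x) ^ 2 ∂P := integral_nonneg fun x => sq_nonneg _
    have e : (fun x => (t * f x - g x) ^ 2) = fun x => t ^ 2 * f x ^ 2 - 2 * t * (f x * g x) + g x ^ 2 := by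
      funext x; ring
    have i1 : Integrable (fun x => t ^ 2 * f x ^ 2) P := hf2.const_mul _
    have i2 : Integrable (fun x => 2 * t * (f x * g x)) P := hfg.const_mul _
    have i12 : Integrable (fun x => t ^ 2 * f x ^ 2 - 2 * t * (f x * g x)) P := i1.sub i2
    rw [e, integral_add i12 hg2, integral_sub i1 i2, integral_const_mul, integral_const_mul] at h1
    linarith
  by_cases hA' : A = 0
  · -- then `B = 0`: take `t → ±∞` in the quadratic
    have hB0 : B = 0 := by
      by_contra hB'
      have h1 := quad ((C + 1) / (2 * B))
      rw [hA', mul_zero, zero_sub] at h1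
      have e1 : 2 * ((C + 1) / (2 * B)) * B = C + 1 := by field_simp
      linarith
    rw [hB0, hA']; simp
  · have hApos : 0 < A := lt_of_le_of_ne hA0 (Ne.symm hA')
    have h1 := quad (B / A)
    have e1 : (B / A) ^ 2 * A - 2 * (B / A) * B + C = (A * C - B ^ 2) / A := by field_simp; ring
    rw [e1] at h1
    have h2 := (div_nonneg_iff.1 h1)
    rcases h2 with ⟨h3, _⟩ | ⟨_, h4⟩
    · linarith
    · linarith [lt_irrefl (0 : ℝ) (lt_of_lt_of_le hApos h4)]

/-- **Cauchy–Schwarz for the covariance**: `(E[XY] − E[X]E[Y])² ≤ E[X²] E[Y²]` for `X, Y ∈ L²` on a probability space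
(the covariance is `E[(X − EX)(Y − EY)]` and `E[(X − EX)²] = E[X²] − (EX)² ≤ E[X²]`). [folklore] -/
theorem sq_cov_le {X Y : E → ℝ} (hX : MemLp X 2 P) (hY : MemLp Y 2 P) :
    (∫ e, X e * Y e ∂P - (∫ e, X e ∂P) * (∫ e, Y e ∂P)) ^ 2 ≤ (∫ e, X e ^ 2 ∂P) * (∫ e, Y e ^ 2 ∂P) := by
  set a := ∫ e, X e ∂P with ha
  set b := ∫ e, Y e ∂P with hb
  have hXc : MemLp (fun e => X e - a) 2 P := hX.sub (memLp_const a)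
  have hYc : MemLp (fun e => Y e - b) 2 P := hY.sub (memLp_const b)
  have hcs := sq_integral_mul_le (P := P) hXc hYc
  have iX : Integrable X P := hX.integrable one_le_two
  have iY : Integrable Y P := hY.integrable one_le_two
  have iXY : Integrable (fun e => X e * Y e) P := hX.integrable_mul hY
  have iX2 : Integrable (fun e => X e ^ 2) P := hX.integrable_sq
  have iY2 : Integrable (fun e => Y e ^ 2) P := hY.integrable_sq
  -- expand the centred integrals
  have iaY : Integrable (fun e => a * Y e) P := iY.const_mul a
  have ibX : Integrable (fun e => b * X e) P := iX.const_mul b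
  have e1 : ∫ e, (X e - a) * (Y e - b) ∂P = ∫ e, X e * Y e ∂P - a * b := by
    have e : (fun e => (X e - a) * (Y e - b)) = fun e => X e * Y e - a * Y e - b * X e + a * b := by funext e; ring
    have j1 : Integrable (fun e => X e * Y e - a * Y e) P := iXY.sub iaY
    have j2 : Integrable (fun e => X e * Y e - a * Y e - b * X e) P := j1.sub ibX
    rw [e, integral_add j2 (integrable_const _), integral_sub j1 ibX, integral_sub iXY iaY,
      integral_const_mul, integral_const_mul, integral_const]
    simp only [probReal_univ, smul_eq_mul, one_mul]; rw [← ha, ← hb]; ring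
  have e2 : ∫ e, (X e - a) ^ 2 ∂P = ∫ e, X e ^ 2 ∂P - a ^ 2 := by
    have e : (fun e => (X e - a) ^ 2) = fun e => X e ^ 2 - 2 * a * X e + a ^ 2 := by funext e; ring
    have i2aX : Integrable (fun e => 2 * a * X e) P := iX.const_mul _
    have j3 : Integrable (fun e => X e ^ 2 - 2 * a * X e) P := iX2.sub i2aX
    rw [e, integral_add j3 (integrable_const _), integral_sub iX2 i2aX, integral_const_mul, integral_const]
    simp only [probReal_univ, smul_eq_mul, one_mul]; rw [← ha]; ring
  have e3 : ∫ e, (Y e - b) ^ 2 ∂P = ∫ e, Y e ^ 2 ∂P - b ^ 2 := by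
    have e : (fun e => (Y e - b) ^ 2) = fun e => Y e ^ 2 - 2 * b * Y e + b ^ 2 := by funext e; ring
    have i2bY : Integrable (fun e => 2 * b * Y e) P := iY.const_mul _
    have j4 : Integrable (fun e => Y e ^ 2 - 2 * b * Y e) P := iY2.sub i2bY
    rw [e, integral_add j4 (integrable_const _), integral_sub iY2 i2bY, integral_const_mul, integral_const]
    simp only [probReal_univ, smul_eq_mul, one_mul]; rw [← hb]; ring
  rw [e1, e2, e3] at hcs
  have hv1 : 0 ≤ ∫ e, X e ^ 2 ∂P - a ^ 2 := by rw [← e2]; exact integral_nonneg fun e => sq_nonneg _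
  have hv2 : 0 ≤ ∫ e, Y e ^ 2 ∂P - b ^ 2 := by rw [← e3]; exact integral_nonneg fun e => sq_nonneg _
  calc (∫ e, X e * Y e ∂P - a * b) ^ 2 ≤ (∫ e, X e ^ 2 ∂P - a ^ 2) * (∫ e, Y e ^ 2 ∂P - b ^ 2) := hcs
    _ ≤ (∫ e, X e ^ 2 ∂P) * (∫ e, Y e ^ 2 ∂P) := by
        apply mul_le_mul (by nlinarith [sq_nonneg a]) (by nlinarith [sq_nonneg b]) hv2
        exact integral_nonneg fun e => sq_nonneg _

/-- `|E[XY] − E[X]E[Y]| ≤ √E[X²] · √E[Y²]` for `X, Y ∈ L²` on a probability space. [folklore] -/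
theorem abs_cov_le {X Y : E → ℝ} (hX : MemLp X 2 P) (hY : MemLp Y 2 P) :
    |∫ e, X e * Y e ∂P - (∫ e, X e ∂P) * (∫ e, Y e ∂P)| ≤
      Real.sqrt (∫ e, X e ^ 2 ∂P) * Real.sqrt (∫ e, Y e ^ 2 ∂P) := by
  rw [← Real.sqrt_mul (integral_nonneg fun e => sq_nonneg _), ← Real.sqrt_sq_eq_abs]
  exact Real.sqrt_le_sqrt (sq_cov_le hX hY)

/-! ### The covariance is `L²`-Lipschitz: quartic remainders move it by `O(‖r‖₂)` -/

/-- **`L²`-stability of the covariance**: for `X, Y, R, S ∈ L²` on a probability space,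
`|Cov(X+R, Y+S) − Cov(X,Y)| ≤ √E[R²] √E[Y²] + √E[X²] √E[S²] + √E[R²] √E[S²]`
(`Cov(X+R,Y+S) = Cov(X,Y) + Cov(R,Y) + Cov(X,S) + Cov(R,S)` and `abs_cov_le`). [folklore] -/
theorem abs_cov_add_sub_cov_le {X Y R S : E → ℝ} (hX : MemLp X 2 P) (hY : MemLp Y 2 P) (hR : MemLp R 2 P)
    (hS : MemLp S 2 P) :
    |(∫ e, (X e + R e) * (Y e + S e) ∂P - (∫ e, (X e + R e) ∂P) * (∫ e, (Y e + S e) ∂P)) -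
        (∫ e, X e * Y e ∂P - (∫ e, X e ∂P) * (∫ e, Y e ∂P))| ≤
      Real.sqrt (∫ e, R e ^ 2 ∂P) * Real.sqrt (∫ e, Y e ^ 2 ∂P) +
        Real.sqrt (∫ e, X e ^ 2 ∂P) * Real.sqrt (∫ e, S e ^ 2 ∂P) +
        Real.sqrt (∫ e, R e ^ 2 ∂P) * Real.sqrt (∫ e, S e ^ 2 ∂P) := by
  have iX : Integrable X P := hX.integrable one_le_two
  have iY : Integrable Y P := hY.integrable one_le_two
  have iR : Integrable R P := hR.integrable one_le_two
  have iS : Integrable S P := hS.integrable one_le_two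
  have iXY : Integrable (fun e => X e * Y e) P := hX.integrable_mul hY
  have iRY : Integrable (fun e => R e * Y e) P := hR.integrable_mul hY
  have iXS : Integrable (fun e => X e * S e) P := hX.integrable_mul hS
  have iRS : Integrable (fun e => R e * S e) P := hR.integrable_mul hS
  have e1 : ∫ e, (X e + R e) * (Y e + S e) ∂P =
      ∫ e, X e * Y e ∂P + ∫ e, R e * Y e ∂P + ∫ e, X e * S e ∂P + ∫ e, R e * S e ∂P := by
    have e : (fun e => (X e + R e) * (Y e + S e)) = fun e => X e * Y e + R e * Y e + X e * S e + R e * S e := by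
      funext e; ring
    have j1 : Integrable (fun e => X e * Y e + R e * Y e) P := iXY.add iRY
    have j2 : Integrable (fun e => X e * Y e + R e * Y e + X e * S e) P := j1.add iXS
    rw [e, integral_add j2 iRS, integral_add j1 iXS, integral_add iXY iRY]
  have e2 : ∫ e, (X e + R e) ∂P = ∫ e, X e ∂P + ∫ e, R e ∂P := integral_add iX iR
  have e3 : ∫ e, (Y e + S e) ∂P = ∫ e, Y e ∂P + ∫ e, S e ∂P := integral_add iY iS
  have hRY := abs_cov_le (P := P) hR hY
  have hXS := abs_cov_le (P := P) hX hS
  have hRS := abs_cov_le (P := P) hR hS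
  have e4 : (∫ e, (X e + R e) * (Y e + S e) ∂P - (∫ e, (X e + R e) ∂P) * (∫ e, (Y e + S e) ∂P)) -
        (∫ e, X e * Y e ∂P - (∫ e, X e ∂P) * (∫ e, Y e ∂P)) =
      (∫ e, R e * Y e ∂P - (∫ e, R e ∂P) * (∫ e, Y e ∂P)) + (∫ e, X e * S e ∂P - (∫ e, X e ∂P) * (∫ e, S e ∂P)) +
        (∫ e, R e * S e ∂P - (∫ e, R e ∂P) * (∫ e, S e ∂P)) := by
    rw [e1, e2, e3]; ring
  rw [e4]
  refine (abs_add_three _ _ _).trans ?_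
  linarith

/-- **Hypothesis (ii) from the quadratic part**: if `Cov(q₀, q_n)` is within `a` of the target `τ` (e.g. `τ = σ C(n)²`, `a = 0` by
Wick's identity), `√E[q₀²], √E[q_n²] ≤ B` and the remainders have `√E[r₀²], √E[r_n²] ≤ ϱ`, then the full reference pair
`(q₀ + r₀, q_n + r_n)` has covariance within `a + 2Bϱ + ϱ²` of `τ`. [folklore] -/
theorem abs_cov_add_sub_le_of_bounds {q₀ qₙ r₀ rₙ : E → ℝ} (hq₀ : MemLp q₀ 2 P) (hqₙ : MemLp qₙ 2 P)
    (hr₀ : MemLp r₀ 2 P) (hrₙ : MemLp rₙ 2 P) {τ a B ϱ : ℝ}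
    (hτ : |(∫ e, q₀ e * qₙ e ∂P - (∫ e, q₀ e ∂P) * (∫ e, qₙ e ∂P)) - τ| ≤ a)
    (hB₀ : Real.sqrt (∫ e, q₀ e ^ 2 ∂P) ≤ B) (hBₙ : Real.sqrt (∫ e, qₙ e ^ 2 ∂P) ≤ B)
    (hϱ₀ : Real.sqrt (∫ e, r₀ e ^ 2 ∂P) ≤ ϱ) (hϱₙ : Real.sqrt (∫ e, rₙ e ^ 2 ∂P) ≤ ϱ) :
    |(∫ e, (q₀ e + r₀ e) * (qₙ e + rₙ e) ∂P - (∫ e, (q₀ e + r₀ e) ∂P) * (∫ e, (qₙ e + rₙ e) ∂P)) - τ| ≤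
      a + 2 * B * ϱ + ϱ ^ 2 := by
  have h := abs_cov_add_sub_cov_le (P := P) hq₀ hqₙ hr₀ hrₙ
  have s0 : 0 ≤ Real.sqrt (∫ e, r₀ e ^ 2 ∂P) := Real.sqrt_nonneg _
  have s1 : 0 ≤ Real.sqrt (∫ e, rₙ e ^ 2 ∂P) := Real.sqrt_nonneg _
  have s2 : 0 ≤ Real.sqrt (∫ e, q₀ e ^ 2 ∂P) := Real.sqrt_nonneg _
  have s3 : 0 ≤ Real.sqrt (∫ e, qₙ e ^ 2 ∂P) := Real.sqrt_nonneg _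
  have t1 : Real.sqrt (∫ e, r₀ e ^ 2 ∂P) * Real.sqrt (∫ e, qₙ e ^ 2 ∂P) ≤ ϱ * B := mul_le_mul hϱ₀ hBₙ s3 (s0.trans hϱ₀)
  have t2 : Real.sqrt (∫ e, q₀ e ^ 2 ∂P) * Real.sqrt (∫ e, rₙ e ^ 2 ∂P) ≤ B * ϱ := mul_le_mul hB₀ hϱₙ s1 (s2.trans hB₀)
  have t3 : Real.sqrt (∫ e, r₀ e ^ 2 ∂P) * Real.sqrt (∫ e, rₙ e ^ 2 ∂P) ≤ ϱ * ϱ := mul_le_mul hϱ₀ hϱₙ s1 (s0.trans hϱ₀)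
  have tri := abs_sub_le
    (∫ e, (q₀ e + r₀ e) * (qₙ e + rₙ e) ∂P - (∫ e, (q₀ e + r₀ e) ∂P) * (∫ e, (qₙ e + rₙ e) ∂P))
    (∫ e, q₀ e * qₙ e ∂P - (∫ e, q₀ e ∂P) * (∫ e, qₙ e ∂P)) τ
  nlinarith

/-! ### Law of total covariance: the «wall» term of a mixture reference -/

section Mixture

variable {S : Type*} [MeasurableSpace S] {μ : Measure S} [IsProbabilityMeasure μ]

omit [MeasurableSpace E] [IsProbabilityMeasure P] [IsProbabilityMeasure μ] in
/-- **Law of total covariance (integral form).** If the three moments of the pair are mixtures over `s ∼ μ` of conditional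
moments `a(s) = E_s[XY]`, `b(s) = E_s[X]`, `c(s) = E_s[Y]` (`E[XY] = ∫ a`, `E[X] = ∫ b`, `E[Y] = ∫ c`), then
`Cov(X,Y) = ∫ (a − b c) dμ + (∫ b c dμ − ∫ b ∫ c)`: mean conditional covariance plus the covariance of the conditional means.
[folklore] -/
theorem cov_mixture_eq {mXY mX mY : ℝ} {a b c : S → ℝ} (ha : Integrable a μ) (hbc : Integrable (fun s => b s * c s) μ)
    (hXY : mXY = ∫ s, a s ∂μ) (hX : mX = ∫ s, b s ∂μ) (hY : mY = ∫ s, c s ∂μ) :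
    mXY - mX * mY = ∫ s, (a s - b s * c s) ∂μ + (∫ s, b s * c s ∂μ - (∫ s, b s ∂μ) * (∫ s, c s ∂μ)) := by
  rw [hXY, hX, hY, integral_sub ha hbc]; ring

omit [MeasurableSpace E] [IsProbabilityMeasure P] in
/-- **The wall term.** Under the hypotheses of `cov_mixture_eq` with conditional means `b, c ∈ L²(μ)`: the covariance of the
mixture differs from the mean conditional covariance by at most `√Var_μ(b) √Var_μ(c) ≤ √E_μ[(b − b̄)²] √E_μ[(c − c̄)²]` for ANY
centring constants `b̄, c̄` — what must be small is the `μ`-fluctuation of the conditional means. [folklore] -/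
theorem abs_cov_mixture_sub_le {mXY mX mY : ℝ} {a b c : S → ℝ} (ha : Integrable a μ) (hb : MemLp b 2 μ) (hc : MemLp c 2 μ)
    (hXY : mXY = ∫ s, a s ∂μ) (hX : mX = ∫ s, b s ∂μ) (hY : mY = ∫ s, c s ∂μ) (b₀ c₀ : ℝ) :
    |(mXY - mX * mY) - ∫ s, (a s - b s * c s) ∂μ| ≤
      Real.sqrt (∫ s, (b s - b₀) ^ 2 ∂μ) * Real.sqrt (∫ s, (c s - c₀) ^ 2 ∂μ) := by
  have hbc : Integrable (fun s => b s * c s) μ := hb.integrable_mul hc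
  rw [cov_mixture_eq ha hbc hXY hX hY, add_sub_cancel_left]
  -- covariance is invariant under centring: `Cov(b,c) = Cov(b − b₀, c − c₀)`
  have hb' : MemLp (fun s => b s - b₀) 2 μ := hb.sub (memLp_const b₀)
  have hc' : MemLp (fun s => c s - c₀) 2 μ := hc.sub (memLp_const c₀)
  have ib : Integrable b μ := hb.integrable one_le_two
  have ic : Integrable c μ := hc.integrable one_le_two
  have key : ∫ s, b s * c s ∂μ - (∫ s, b s ∂μ) * (∫ s, c s ∂μ) =
      ∫ s, (b s - b₀) * (c s - c₀) ∂μ - (∫ s, (b s - b₀) ∂μ) * (∫ s, (c s - c₀) ∂μ) := by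
    have e : (fun s => (b s - b₀) * (c s - c₀)) = fun s => b s * c s - b₀ * c s - c₀ * b s + b₀ * c₀ := by funext s; ring
    have i1 : Integrable (fun s => b₀ * c s) μ := ic.const_mul b₀
    have i2 : Integrable (fun s => c₀ * b s) μ := ib.const_mul c₀
    have j1 : Integrable (fun s => b s * c s - b₀ * c s) μ := hbc.sub i1
    have j2 : Integrable (fun s => b s * c s - b₀ * c s - c₀ * b s) μ := j1.sub i2
    rw [e, integral_add j2 (integrable_const _), integral_sub j1 i2, integral_sub hbc i1,
      integral_const_mul, integral_const_mul, integral_const, integral_sub ib (integrable_const _),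
      integral_sub ic (integrable_const _), integral_const, integral_const]
    simp only [probReal_univ, smul_eq_mul, one_mul]; ring
  rw [key]
  exact abs_cov_le hb' hc'

end Mixture

end Summit.QuantumFields.YangMills.Theorems.EntropyBudgetEquipartition.CovTransfer

end
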